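import Summits.QuantumFields.YangMills.Theorems.BalabanUVNodesN19TiltPathEndpoints
import Literature.Probability.Process.CondExpInvariance

/-!
# BalabanUVNodes ∕ node N14 = NE1′ — LENS control CARD 11, THE N14-LANE REMAINDER (I): the TUNED law channel at tower level (K11b ∕ (F2″))
# and the free `s`-window (R1 ∕ R1′)

Cell `pub-ymgap`, HUMAN RULING D-0062 (Track A at full width), seat `pub-ymgap-dag-n14-c` (R134 ACCELERATION, strategy s1), generation 7 (idle re-seat);
route `Summits/QuantumFields/YangMills/Theses/BalabanUVNodes.lean` rev 18∕19 (cluster K3⁗ `SpineGivenEndpointR13Sep` = stmt-QuantumFields-20292,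
`--kind proof --supports … --as helper`); venue ruling R424 (`YangMills/Theorems`, namespace `YMDAG.N14.LawChannelTuned`).  ADDITIVE — imports dag-n19-c's
`…N19TiltPathEndpoints` (K11-FH ∕ K11a ∕ K11c on the countertermed chord — CITED, never re-proved; it brings module I `…N19TiltPathCalculus` and this
lineage's file P `…N14LawChannel`) and the tree's `Literature/Probability/Process/CondExpInvariance` (Bayes invariance under an `m`-measurable density);
THEOREMS ONLY (0 `def`), modifies nothing.

SOURCE OF RECORD.  LENS control v6.0 §B (B3)–(B4) (planner seat `ym-lens-BalabanUVNodes-control` g7, memo `LENS-control.md` v6.0 b6dee8b86c4ff517, farm-checked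
sketch `Sketch-control-g7.lean` d9b91efbe9c6728d §2 ∕ §4 ∕ §5 — SIGNATURES LIFTED VERBATIM WITH CREDIT; pub-ymgap INBOX 2026-08-27T06:28Z; row s17 «tuned signatures
free to lift with credit, idle-seat only»), and dag-n19-c g9's module II `…N19TiltPathEndpoints` §2 (K11-FH ∕ K11a ∕ K11c typed there; its header names the items
below as «NOT typed (N14-lane memo items)»).  Bodies are this seat's.

WHAT THIS IS.
* §1 [folklore ∘ K11a + file P + `T4CauchySum`] THE TUNED LAW CHANNEL AT TOWER LEVEL: `abs_tiltedMean_succ_sub_le_of_tunedLawChannel` (one step: run `K+1`'s law pushes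
  forward along `π K` to `(μ K).tilted (D K)`, fibre-blind observables, and the interpolated covariances of `F K` with the PATH DIRECTION `D K + κ_K′(u)·S K` along ANY C¹
  countertermed chord `(μ K).tilted (s·F K + u·D K + κ_K(u)·S K)`, `κ_K 0 = κ_K 1 = 0`, bounded by `η K` ⇒ one-step matching `≤ η K`),
  `matchingModConstants_of_tunedLawChannelTower`, `cauchySeq_genFun_of_tunedLawChannelTower`, and ★ **K11b `cauchySeq_genFun_of_tunedCondDefectTower`** — (F2″):
  with `F K` measurable for the unit-field σ-algebra `m K`, the summable L¹-OSCILLATION of the CONDITIONED COUNTERTERMED defect `μ♮_{K,u,s}[D K + κ_K′(u)·S K | m K]`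
  gives Cauchy generating functions (`η K = B₀·b K`) — file P §3 `cauchySeq_genFun_of_condDefectTower` is the straight case `κ ≡ 0`.
* §2 [folklore] THE `s`-WINDOW IS FREE: **R1 `condExp_tilted_add_ae_eq`** (an `m`-measurable bounded tilt `g` never changes a conditional expectation given `m`:
  `(μ.tilted (g + f))[X | m] = (μ.tilted f)[X | m]` a.e. — the tree's `CondExpInvariance.condExp_ae_eq_condExp_of_eq_withDensity` BY NAME on Mathlib's `tilted_tilted`),
  **R1′ `osc_tilted_le`** (a bounded tilt `|g| ≤ G` of a probability law moves L¹-oscillations by at most `2e^{2G}`).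
* COMPANIONS (same seat, same day; 400-line rule): `…N14LawChannelStraightChord` — R2 `condExp_tilted_mono` (the conditioned defect is non-decreasing along the
  STRAIGHT path; kernel-free conditional Chebyshev through the tree's `CondExpBayes`) and the N1 TOY `toy_matchedEndpoints_cov_ne_zero` (matched endpoints, non-vanishing
  first-order term on `Bool × Bool`); `…N14LawChannelTunedPath` — K11c′ `exists_tuned_path` (existence ∕ C¹-regularity of the tuned counterterm).

WHAT THIS IS NOT.  Everything here is PROVED (0 `sorry`, 0 named facts) on hypothesis shapes.  The countertermed chord is LENS control's CURRENCY (F2″) — «a repaired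
currency, NOT an estimate, NOT on N14's critical path; it gains only in PRODUCTION» (memo §B (B3); lens HANDOFF gen 9 (D3)); nothing of Bałaban's (the runs' laws, the
one-step defect `D K`, the marginal monomial `S K`, the tuned `κ_K`) is instantiated.  N14 ∕ N19 NOT discharged; count-neutral.  One finite four-torus
programme at fixed ε; NOT ℝ⁴, NOT OS, NOT a mass gap, NOT Clay.
-/

set_option autoImplicit false

noncomputable section

namespace YMDAG.N14.LawChannelTuned

open MeasureTheory ProbabilityTheory Set Filter Topology
open scoped ENNReal
open Literature.MathematicalPhysics.QuantumFieldTheory.Balaban1983to89.T4CauchySum (MatchingModConstants genFun cauchySeq_genFun)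
open Summit.QuantumFields.BalabanUV.T4Continuum.NE1p.DressedMGFForm (tiltedMean matchingModConstants_of_tiltedMeans)
open YMDAG.N14.ConvexFibreCauchy (tiltedMean_map)
open YMDAG.N14.LawChannel (abs_cov_le_of_condExp isProbabilityMeasure_tilted_of_abs_le)
open Summit.QuantumFields.YangMills.BalabanUVNodes.N19TiltPathCalculus (integrable_of_abs_le)
open Summit.QuantumFields.YangMills.BalabanUVNodes.N19TiltPathEndpoints (abs_tiltedMean_tilted_sub_le_of_cov_counterterm)

/-! ## §1 K11b — the tuned law channel at tower level: (F2″) -/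
section Tower

variable {Ω : ℕ → Type*} [∀ K, MeasurableSpace (Ω K)] {l₀ B₀ vol : ℝ} {η : ℕ → ℝ} {CD CS : ℕ → ℝ}
  {μ : ∀ K, Measure (Ω K)} {π : ∀ K, Ω (K + 1) → Ω K} {F D S : ∀ K, Ω K → ℝ} {Z : ℕ → ℝ → ℝ} {κ κ' : ℕ → ℝ → ℝ}

/-- **THE ONE-STEP MATCHING FROM THE TUNED LAW CHANNEL** [folklore ∘ K11a (dag-n19-c `…N19TiltPathEndpoints.abs_tiltedMean_tilted_sub_le_of_cov_counterterm`, CITED) +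
file K `tiltedMean_map`].  Run laws `μ K` (probability); `π K` measurable; run `K+1`'s law PUSHES FORWARD along `π K` to `(μ K).tilted (D K)` (`D K` measurable, bounded);
fibre-blind observables `F (K+1) = F K ∘ π K` (`|F K| ≤ B₀`); a bounded measurable marginal monomial `S K` and ANY C¹ counterterm `κ_K` with `κ_K 0 = κ_K 1 = 0`; ONE scalar
family bounds the interpolated covariances with the PATH DIRECTION, `|Cov_{(μ K).tilted (s·F K + u·D K + κ_K(u)·S K)}(F K, D K + κ_K′(u)·S K)| ≤ η K` (`|s| ≤ l₀`, `u ∈ [0,1]`).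
Then `|tiltedMean (F (K+1)) (μ (K+1)) s − tiltedMean (F K) (μ K) s| ≤ η K` on `|s| ≤ l₀`.  File P's `abs_tiltedMean_succ_sub_le_of_lawChannel` is `κ ≡ 0`. -/
theorem abs_tiltedMean_succ_sub_le_of_tunedLawChannel (hμ : ∀ K, IsProbabilityMeasure (μ K)) (hπ : ∀ K, Measurable (π K))
    (hFm : ∀ K, Measurable (F K)) (hFb : ∀ K x, |F K x| ≤ B₀) (hFπ : ∀ K ω, F (K + 1) ω = F K (π K ω))
    (hDm : ∀ K, Measurable (D K)) (hDb : ∀ K x, |D K x| ≤ CD K) (hpush : ∀ K, (μ (K + 1)).map (π K) = (μ K).tilted (D K))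
    (hSm : ∀ K, Measurable (S K)) (hSb : ∀ K x, |S K x| ≤ CS K)
    (hκ : ∀ K u, HasDerivAt (κ K) (κ' K u) u) (hκ' : ∀ K, Continuous (κ' K)) (hκ0 : ∀ K, κ K 0 = 0) (hκ1 : ∀ K, κ K 1 = 0)
    (hc : ∀ K (s : ℝ), |s| ≤ l₀ → ∀ u ∈ Set.Icc (0 : ℝ) 1,
      |cov[F K, fun x => D K x + κ' K u * S K x; (μ K).tilted fun x => s * F K x + u * D K x + κ K u * S K x]| ≤ η K)
    (K : ℕ) {s : ℝ} (hs : |s| ≤ l₀) :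
    |tiltedMean (F (K + 1)) (μ (K + 1)) s - tiltedMean (F K) (μ K) s| ≤ η K := by
  haveI := hμ K
  have hcomp : F (K + 1) = (F K) ∘ π K := funext (hFπ K)
  rw [hcomp, ← tiltedMean_map (hπ K) (hFm K), hpush K]
  exact abs_tiltedMean_tilted_sub_le_of_cov_counterterm (hFm K) (hFb K) (hDm K) (hDb K) (hSm K) (hSb K) (hκ K) (hκ' K)
    (hκ0 K) (hκ1 K) (hc K s hs)

/-- **N19's SHAPE FROM THE TUNED LAW CHANNEL** [folklore ∘ the previous theorem + gaps-ne1's `matchingModConstants_of_tiltedMeans`]: under the same hypotheses and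
`vol > 0`, `T4CauchySum.MatchingModConstants vol l₀ (fun K => l₀∕vol·η K) Z` for `Z K t = mgf (F K) (μ K) t`. -/
theorem matchingModConstants_of_tunedLawChannelTower (hvol : 0 < vol) (hμ : ∀ K, IsProbabilityMeasure (μ K)) (hπ : ∀ K, Measurable (π K))
    (hFm : ∀ K, Measurable (F K)) (hFb : ∀ K x, |F K x| ≤ B₀) (hFπ : ∀ K ω, F (K + 1) ω = F K (π K ω))
    (hDm : ∀ K, Measurable (D K)) (hDb : ∀ K x, |D K x| ≤ CD K) (hpush : ∀ K, (μ (K + 1)).map (π K) = (μ K).tilted (D K))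
    (hSm : ∀ K, Measurable (S K)) (hSb : ∀ K x, |S K x| ≤ CS K)
    (hκ : ∀ K u, HasDerivAt (κ K) (κ' K u) u) (hκ' : ∀ K, Continuous (κ' K)) (hκ0 : ∀ K, κ K 0 = 0) (hκ1 : ∀ K, κ K 1 = 0)
    (hc : ∀ K (s : ℝ), |s| ≤ l₀ → ∀ u ∈ Set.Icc (0 : ℝ) 1,
      |cov[F K, fun x => D K x + κ' K u * S K x; (μ K).tilted fun x => s * F K x + u * D K x + κ K u * S K x]| ≤ η K)
    (hZ : ∀ K t, Z K t = mgf (F K) (μ K) t) :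
    MatchingModConstants vol l₀ (fun K => l₀ / vol * η K) Z := by
  haveI : ∀ K, IsFiniteMeasure (μ K) := fun K => by haveI := hμ K; infer_instance
  refine matchingModConstants_of_tiltedMeans (μ := μ) (η := η) hFm hFb hZ (fun K s hs => ?_) (fun K => le_of_eq (by field_simp))
  exact abs_tiltedMean_succ_sub_le_of_tunedLawChannel hμ hπ hFm hFb hFπ hDm hDb hpush hSm hSb hκ hκ' hκ0 hκ1 hc K hs

/-- **THE T⁴ CAUCHY PROPERTY FROM ONE SUMMABLE SCALAR FAMILY, TUNED** [folklore ∘ the previous theorem + `T4CauchySum.cauchySeq_genFun`]: if moreover `l₀ ≥ 0` and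
`Σ η K < ∞`, every generating function `K ↦ genFun Z K t`, `|t| ≤ l₀`, is Cauchy. -/
theorem cauchySeq_genFun_of_tunedLawChannelTower (hvol : 0 < vol) (hl₀ : 0 ≤ l₀) (hμ : ∀ K, IsProbabilityMeasure (μ K)) (hπ : ∀ K, Measurable (π K))
    (hFm : ∀ K, Measurable (F K)) (hFb : ∀ K x, |F K x| ≤ B₀) (hFπ : ∀ K ω, F (K + 1) ω = F K (π K ω))
    (hDm : ∀ K, Measurable (D K)) (hDb : ∀ K x, |D K x| ≤ CD K) (hpush : ∀ K, (μ (K + 1)).map (π K) = (μ K).tilted (D K))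
    (hSm : ∀ K, Measurable (S K)) (hSb : ∀ K x, |S K x| ≤ CS K)
    (hκ : ∀ K u, HasDerivAt (κ K) (κ' K u) u) (hκ' : ∀ K, Continuous (κ' K)) (hκ0 : ∀ K, κ K 0 = 0) (hκ1 : ∀ K, κ K 1 = 0)
    (hc : ∀ K (s : ℝ), |s| ≤ l₀ → ∀ u ∈ Set.Icc (0 : ℝ) 1,
      |cov[F K, fun x => D K x + κ' K u * S K x; (μ K).tilted fun x => s * F K x + u * D K x + κ K u * S K x]| ≤ η K)
    (hηs : Summable η) (hZ : ∀ K t, Z K t = mgf (F K) (μ K) t) {t : ℝ} (ht : |t| ≤ l₀) : CauchySeq fun K => genFun Z K t :=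
  cauchySeq_genFun (matchingModConstants_of_tunedLawChannelTower hvol hμ hπ hFm hFb hFπ hDm hDb hpush hSm hSb hκ hκ' hκ0 hκ1 hc hZ) hl₀
    (hηs.mul_left _) ht

end Tower

/-! ### K11b in the lens's letters: the conditioned COUNTERTERMED defect (F2″) -/
section CondDefect

variable {Ω : ℕ → Type*} {m : ∀ K, MeasurableSpace (Ω K)} [mΩ : ∀ K, MeasurableSpace (Ω K)] {l₀ B₀ vol : ℝ} {CD CS b : ℕ → ℝ}
  {μ : ∀ K, Measure (Ω K)} {π : ∀ K, Ω (K + 1) → Ω K} {F D S : ∀ K, Ω K → ℝ} {Z : ℕ → ℝ → ℝ} {κ κ' : ℕ → ℝ → ℝ}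

/-- **K11b — (F2″) THE TUNED CONDITIONED DEFECT** (LENS control CARD 11; signature = `Sketch-control-g7.lean` §2, credited).  File P §3
`cauchySeq_genFun_of_condDefectTower` with the straight interpolation replaced by a countertermed path `μ♮_{K,u,s} := (μ K).tilted (s·F K + u·D K + κ_K(u)·S K)`,
`κ_K 0 = κ_K 1 = 0` (`S K` = the marginal monomial of run `K`'s coordinates, e.g. its Wilson plaquette action; `κ_K` = the bare-coupling re-tuning along the path):
if the L¹-oscillation of `μ♮[D K + κ_K′(u)·S K | m K]` is `≤ b K` on the window and `Σ b K < ∞`, the generating functions are Cauchy (`η K = B₀·b K`).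
[folklore ∘ §1 + file P `abs_cov_le_of_condExp`] -/
theorem cauchySeq_genFun_of_tunedCondDefectTower (hvol : 0 < vol) (hl₀ : 0 ≤ l₀)
    (hμ : ∀ K, IsProbabilityMeasure (μ K)) (hπ : ∀ K, Measurable (π K)) (hm : ∀ K, m K ≤ mΩ K)
    (hFm : ∀ K, StronglyMeasurable[m K] (F K)) (hFb : ∀ K x, |F K x| ≤ B₀) (hFπ : ∀ K ω, F (K + 1) ω = F K (π K ω))
    (hDm : ∀ K, Measurable (D K)) (hDb : ∀ K x, |D K x| ≤ CD K) (hpush : ∀ K, (μ (K + 1)).map (π K) = (μ K).tilted (D K))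
    (hSm : ∀ K, Measurable (S K)) (hSb : ∀ K x, |S K x| ≤ CS K)
    (hκ : ∀ K u, HasDerivAt (κ K) (κ' K u) u) (hκ' : ∀ K, Continuous (κ' K)) (hκ0 : ∀ K, κ K 0 = 0) (hκ1 : ∀ K, κ K 1 = 0)
    (hb : ∀ K (s : ℝ), |s| ≤ l₀ → ∀ u ∈ Set.Icc (0 : ℝ) 1,
      ∫ x, |(((μ K).tilted fun x => s * F K x + u * D K x + κ K u * S K x)[fun x => D K x + κ' K u * S K x|m K]) x -
          ∫ y, (D K y + κ' K u * S K y) ∂((μ K).tilted fun x => s * F K x + u * D K x + κ K u * S K x)|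
        ∂((μ K).tilted fun x => s * F K x + u * D K x + κ K u * S K x) ≤ b K)
    (hbs : Summable b) (hZ : ∀ K t, Z K t = mgf (F K) (μ K) t) {t : ℝ} (ht : |t| ≤ l₀) :
    CauchySeq fun K => genFun Z K t := by
  have hFm₀ : ∀ K, Measurable (F K) := fun K => ((hFm K).mono (hm K)).measurable
  have hB₀ : 0 ≤ B₀ := by
    haveI := hμ 0
    obtain ⟨x⟩ := nonempty_of_measure_ne_zero (μ := μ 0) (s := Set.univ) (by simp)
    exact (abs_nonneg _).trans (hFb 0 x)
  refine cauchySeq_genFun_of_tunedLawChannelTower (η := fun K => B₀ * b K) hvol hl₀ hμ hπ hFm₀ hFb hFπ hDm hDb hpush hSm hSb hκ hκ' hκ0 hκ1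
    (fun K s hs u hu => ?_) (hbs.mul_left B₀) hZ ht
  haveI := hμ K
  have hexm : Measurable fun x => s * F K x + u * D K x + κ K u * S K x :=
    ((measurable_const.mul (hFm₀ K)).add (measurable_const.mul (hDm K))).add (measurable_const.mul (hSm K))
  haveI : IsProbabilityMeasure ((μ K).tilted fun x => s * F K x + u * D K x + κ K u * S K x) :=
    isProbabilityMeasure_tilted_of_abs_le (ν := μ K) (C := |s| * B₀ + |u| * CD K + |κ K u| * CS K) hexm fun x =>
      (abs_add_le _ _).trans (add_le_add ((abs_add_le _ _).trans (add_le_add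
        (by rw [abs_mul]; exact mul_le_mul_of_nonneg_left (hFb K x) (abs_nonneg s))
        (by rw [abs_mul]; exact mul_le_mul_of_nonneg_left (hDb K x) (abs_nonneg u))))
        (by rw [abs_mul]; exact mul_le_mul_of_nonneg_left (hSb K x) (abs_nonneg _)))
  have hdirm : Measurable fun x => D K x + κ' K u * S K x := (hDm K).add (measurable_const.mul (hSm K))
  have hdirb : ∀ x, |D K x + κ' K u * S K x| ≤ CD K + |κ' K u| * CS K := fun x =>
    (abs_add_le _ _).trans (add_le_add (hDb K x) (by rw [abs_mul]; exact mul_le_mul_of_nonneg_left (hSb K x) (abs_nonneg _)))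
  exact (abs_cov_le_of_condExp (hm K) (hFm K) (hFb K) hdirm hdirb).trans (mul_le_mul_of_nonneg_left (hb K s hs u hu) hB₀)

end CondDefect


/-! ## §2 R1 ∕ R1′ — the `s`-window is free -/
section Window

/-- **R1 — AN `m`-MEASURABLE TILT NEVER CHANGES A CONDITIONAL EXPECTATION GIVEN `m`** (LENS control sketch §4, credited; = the tree's
`Literature.Probability.Process.condExp_ae_eq_condExp_of_eq_withDensity` BY NAME on Mathlib's `tilted_tilted`): for a finite nonzero `μ`, a sub-σ-algebra `m ≤ m₀`,
an `m`-measurable bounded tilt `g` (the law channel's `s·F K`, `F K` unit-field measurable) and bounded measurable `f`, `X`: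
`(μ.tilted (g + f))[X | m] = (μ.tilted f)[X | m]` almost everywhere.  So the conditioned (countertermed) defect is `s`-INDEPENDENT; `s` enters only through the
unit-field marginal. [folklore] -/
theorem condExp_tilted_add_ae_eq {Ω : Type*} {m m₀ : MeasurableSpace Ω} {μ : Measure Ω} [IsFiniteMeasure μ] [NeZero μ] (hm : m ≤ m₀)
    {g f X : Ω → ℝ} (hgm : Measurable[m] g) {Cg : ℝ} (hgb : ∀ x, |g x| ≤ Cg) (hfm : Measurable f) {Cf : ℝ} (hfb : ∀ x, |f x| ≤ Cf)
    (hXm : Measurable X) {CX : ℝ} (hXb : ∀ x, |X x| ≤ CX) :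
    (μ.tilted fun x => g x + f x)[X|m] =ᵐ[μ.tilted fun x => g x + f x] (μ.tilted f)[X|m] := by
  have hgm₀ : Measurable g := hgm.mono hm le_rfl
  have hfi : Integrable (fun x => Real.exp (f x)) μ :=
    integrable_of_abs_le (Real.measurable_exp.comp hfm) fun x => by
      rw [Real.abs_exp]; exact Real.exp_le_exp.2 ((le_abs_self _).trans (hfb x))
  have heq : (μ.tilted fun x => g x + f x) = (μ.tilted f).tilted g := by
    rw [tilted_tilted hfi g]
    congr 1
    funext x
    simp only [Pi.add_apply]
    ring
  haveI : IsProbabilityMeasure (μ.tilted f) := isProbabilityMeasure_tilted hfi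
  have hgi : Integrable (fun x => Real.exp (g x)) (μ.tilted f) :=
    integrable_of_abs_le (Real.measurable_exp.comp hgm₀) fun x => by
      rw [Real.abs_exp]; exact Real.exp_le_exp.2 ((le_abs_self _).trans (hgb x))
  haveI : IsProbabilityMeasure ((μ.tilted f).tilted g) := isProbabilityMeasure_tilted hgi
  -- the second tilt is a change of measure by an `m`-MEASURABLE density
  have hρ : Measurable[m] fun x => ENNReal.ofReal (Real.exp (g x) / ∫ y, Real.exp (g y) ∂(μ.tilted f)) :=
    ((Real.measurable_exp.comp hgm).div_const _).ennreal_ofReal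
  have hν : (μ.tilted f).tilted g =
      (μ.tilted f).withDensity (fun x => ENNReal.ofReal (Real.exp (g x) / ∫ y, Real.exp (g y) ∂(μ.tilted f))) := rfl
  rw [heq]
  exact Literature.Probability.Process.condExp_ae_eq_condExp_of_eq_withDensity hm hρ hν
    (integrable_of_abs_le hXm hXb) (integrable_of_abs_le hXm hXb)

/-- **R1′ — THE `s`-WINDOW COSTS `2e^{2G}`** (LENS control sketch §4, credited): for an integrable `h` and a bounded measurable tilt `g` (`|g| ≤ G`) of a probability
law `ν`, `∫ |h − ∫ h dν^g| dν^g ≤ 2e^{2G} ∫ |h − ∫ h dν| dν` (`ν^g = ν.tilted g`; its density lies in `[e^{−2G}, e^{2G}]`; re-centring costs the factor `2`). [folklore] -/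
theorem osc_tilted_le {Ω : Type*} [MeasurableSpace Ω] (ν : Measure Ω) [IsProbabilityMeasure ν] {h g : Ω → ℝ} (hh : Integrable h ν)
    (hgm : Measurable g) {G : ℝ} (hgb : ∀ x, |g x| ≤ G) :
    ∫ x, |h x - ∫ y, h y ∂(ν.tilted g)| ∂(ν.tilted g) ≤ 2 * Real.exp (2 * G) * ∫ x, |h x - ∫ y, h y ∂ν| ∂ν := by
  have hgi : Integrable (fun x => Real.exp (g x)) ν :=
    integrable_of_abs_le (Real.measurable_exp.comp hgm) fun x => by
      rw [Real.abs_exp]; exact Real.exp_le_exp.2 ((le_abs_self _).trans (hgb x))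
  haveI : IsProbabilityMeasure (ν.tilted g) := isProbabilityMeasure_tilted hgi
  set Z : ℝ := ∫ y, Real.exp (g y) ∂ν with hZdef
  have hZ : Real.exp (-G) ≤ Z := by
    have hmono := integral_mono (integrable_const (Real.exp (-G))) hgi fun x =>
      Real.exp_le_exp.2 (neg_le.1 ((neg_le_abs (g x)).trans (hgb x)))
    simpa using hmono
  have hZpos : 0 < Z := (Real.exp_pos _).trans_le hZ
  have hdens : ∀ x, Real.exp (g x) / Z ≤ Real.exp (2 * G) := fun x => by
    rw [div_le_iff₀ hZpos]
    calc Real.exp (g x) ≤ Real.exp G := Real.exp_le_exp.2 ((le_abs_self _).trans (hgb x))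
      _ = Real.exp (2 * G) * Real.exp (-G) := by rw [← Real.exp_add]; ring_nf
      _ ≤ Real.exp (2 * G) * Z := mul_le_mul_of_nonneg_left hZ (Real.exp_pos _).le
  have hdens0 : ∀ x, 0 ≤ Real.exp (g x) / Z := fun x => div_nonneg (Real.exp_pos _).le hZpos.le
  -- `h` stays integrable under the bounded tilt
  have hh' : Integrable h (ν.tilted g) := by
    rw [integrable_tilted_iff hgi]
    simp_rw [smul_eq_mul]
    refine hh.bdd_mul (c := Real.exp G) (Real.measurable_exp.comp hgm).aestronglyMeasurable (Eventually.of_forall fun x => ?_)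
    rw [Real.norm_eq_abs, Real.abs_exp]
    exact Real.exp_le_exp.2 ((le_abs_self _).trans (hgb x))
  set c : ℝ := ∫ y, h y ∂ν with hc
  set c' : ℝ := ∫ y, h y ∂(ν.tilted g) with hc'
  have hi1 : Integrable (fun x => |h x - c|) ν := (hh.sub (integrable_const c)).abs
  have hi1' : Integrable (fun x => |h x - c|) (ν.tilted g) := (hh'.sub (integrable_const c)).abs
  -- step 1: the density bound on the non-negative integrand `|h − c|`
  have key : ∫ x, |h x - c| ∂(ν.tilted g) ≤ Real.exp (2 * G) * ∫ x, |h x - c| ∂ν := by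
    rw [integral_tilted, ← integral_const_mul]
    refine integral_mono_of_nonneg (Eventually.of_forall fun x => ?_) (hi1.const_mul _) (Eventually.of_forall fun x => ?_)
    · exact smul_nonneg (hdens0 x) (abs_nonneg _)
    · show (Real.exp (g x) / ∫ y, Real.exp (g y) ∂ν) • |h x - c| ≤ Real.exp (2 * G) * |h x - c|
      rw [smul_eq_mul]
      exact mul_le_mul_of_nonneg_right (hdens x) (abs_nonneg _)
  -- step 2: re-centring at the tilted mean costs a factor 2
  have hcc' : |c - c'| ≤ ∫ x, |h x - c| ∂(ν.tilted g) := by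
    have e : c' - c = ∫ x, (h x - c) ∂(ν.tilted g) := by
      rw [integral_sub hh' (integrable_const c), integral_const, smul_eq_mul, probReal_univ, one_mul]
    rw [abs_sub_comm, e]
    exact abs_integral_le_integral_abs
  have htri : ∀ x, |h x - c'| ≤ |h x - c| + |c - c'| := fun x => by
    calc |h x - c'| = |(h x - c) + (c - c')| := by ring_nf
      _ ≤ |h x - c| + |c - c'| := abs_add_le _ _
  have hpos : 0 ≤ ∫ x, |h x - c| ∂ν := integral_nonneg fun x => abs_nonneg _
  calc ∫ x, |h x - c'| ∂(ν.tilted g) ≤ ∫ x, (|h x - c| + |c - c'|) ∂(ν.tilted g) :=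
        integral_mono_of_nonneg (Eventually.of_forall fun x => abs_nonneg _) (hi1'.add (integrable_const _))
          (Eventually.of_forall htri)
    _ = (∫ x, |h x - c| ∂(ν.tilted g)) + |c - c'| := by
        rw [integral_add hi1' (integrable_const _), integral_const, smul_eq_mul, probReal_univ, one_mul]
    _ ≤ 2 * ∫ x, |h x - c| ∂(ν.tilted g) := by linarith
    _ ≤ 2 * (Real.exp (2 * G) * ∫ x, |h x - c| ∂ν) := by linarith [key]
    _ = 2 * Real.exp (2 * G) * ∫ x, |h x - c| ∂ν := by ring

end Window


end YMDAG.N14.LawChannelTuned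

end
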